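import Summits.Ventures.CertifiedArithmetic.Expansions.Orient2dEstimate
import Literature.ComputerArithmetic.Shewchuk1997.FastExpansionSum
import Literature.ComputerArithmetic.BoldoJeannerodMelquiondMuller2023.ExactAddition
import Literature.ComputerArithmetic.BoldoJeannerodMelquiondMuller2023.DirectedRoundings
import Mathlib.Tactic.Linarith
import Mathlib.Tactic.Positivity
import Mathlib.Tactic.Ring
import Mathlib.Tactic.NormNum

/-!
# APPROXIMATE of a COMPRESSed expansion is a faithful rounding of its value

NEW WORK, HONEST FRAMING: a modest, fully checked observation about two procedures of
Shewchuk 1997 §2.7–2.8 (restated with full proofs under `Literature/…/Shewchuk1997/`); it is not in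
that paper and we know of no printed statement of it. The printed neighbours are PRIEST's
renormalisation and its descendants (Boldo–Joldes–Muller–Popescu, ITP 2017: the output is
*ulp-nonoverlapping*), which control the SHAPE of the output expansion, not the one float read
off it. Setting: precision-`p` binary floats with gradual underflow (`IsFloat p emin`), a
round-to-nearest `fl` (`IsRoundNearest`) with nonadjacent roundoff (`RoundoffBelow 2 fl`;
round-half-to-even has it), a nonoverlapping expansion `e` of floats, smallest first, zeros
allowed (`IsExpansion 1 e`); `estimate` = APPROXIMATE (add smallest first), `compress` =
COMPRESS; `IsFaithful` = faithful rounding in the sense of Boldo–Jeannerod–Melquiond–Muller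
(Acta Numerica 2023, §2.2: the result is `RD` or `RU` of the argument).

**Theorem** (`estimate_compress_faithful`, `p ≥ 3`). `A := estimate fl (compress fl e)` is a
faithful rounding of `Σ e`. Hence `A = Σ e` when `Σ e` is a float (`estimate_compress_eq_sum`),
`A` has exactly the sign of `Σ e` (`estimate_compress_pos_iff` / `_neg_iff`), and
`|A − Σ e| < ulp (Σ e)` (`abs_estimate_compress_sub_sum_lt_ulp`, their Property 2.8);
round-half-to-even instance `estimate_compress_faithful_roundTiesEven`. Contrast: plain
APPROXIMATE on a nonoverlapping expansion is not faithful — it returns `0` on `⟨15/16, 15, −16⟩`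
(`p = 4`, value `−1/16`) and errs by nearly `(5/2)·2^-p·|Σ|` even on Shewchuk's own outputs;
one COMPRESS pass (≈ `6m` flops for length `m`) repairs this.

Mechanism. (1) `estimate_bounds_of_nonadjacent`: on a NONADJACENT expansion of floats with
`2|x| < 2^s`, `|estimate| ≤ 2^s/2` and `|estimate − Σ| ≤ 2^s·2^-p/3` (each rounding error is at
most a quarter-binade of the next component and binades are ≥ 2 apart). (2) COMPRESS returns
`rest ++ [L]`, nonadjacent, with `|Σ rest| < ulp L` (Theorem 23, `compress_spec`); writing
`L = M·2^v` with `M` odd, `rest` lies below `2^v/2`, so the running value `Q` meeting `L` has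
`|Q − Σ rest| ≤ ulp(L)/6`. (3) `isFaithful_of_grid`: `A = fl (Q + L)` and every float of
magnitude `≥ |Σ| − ulp(L)/6` are multiples of `ulp(L)/2` (of `2^emin` if `L` is subnormal); a
float `F` strictly between `Σ` and `A` would, by round-to-nearest minimality, have `Q + L` beyond
it and within `ulp(L)/6`, forcing `|A − F| ≤ ulp(L)/3 < ulp(L)/2 ≤ |A − F|`.

Not claimed. The result need not be the NEAREST float: `p = 4`, `e = ⟨−1, −2, −4, −24, 576⟩`
(value `545`) compresses to `⟨1, 32, 512⟩`, `estimate` gives `512 = RD(545)`, `RN(545) = 576`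
(the inherited error puts `Q + L = 544` on a midpoint). The proof uses `p ≥ 3` and
`RoundoffBelow 2`; nothing is claimed for `p = 2` or other tie rules. Reference check (an
exhaustive exact integer model of both procedures under round-half-to-even): `p = 2..5`,
`6.0·10^4 / 7.5·10^4 / 4.6·10^6 / 9.9·10^5` signed nonoverlapping inputs of length `≤ 6`, no
unfaithful case.
-/

namespace Summit.Ventures.CertifiedArithmetic.Expansions

open Literature.ComputerArithmetic.JeannerodRump2018
open Literature.ComputerArithmetic.BoldoJeannerodMelquiondMuller2023 hiding twoSum twoSum_fst
open Literature.ComputerArithmetic.JoldesMullerPopescu2017 (isFloat_two_zpow abs_fl_le_of_abs_le)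
open Literature.ComputerArithmetic.Shewchuk1997

variable {p : ℕ} {emin : ℤ} {fl : ℚ → ℚ}

/-- Unfolding `estimate` at the top component. -/
private theorem estimate_snoc (fl : ℚ → ℚ) {l : List ℚ} (hl : l ≠ []) (x : ℚ) :
    estimate fl (l ++ [x]) = fl (estimate fl l + x) := by
  obtain ⟨e, es, rfl⟩ := List.exists_cons_of_ne_nil hl
  simp [estimate, List.foldl_append]

/-- `estimate` of a list of floats is a float. -/
private theorem estimate_isFloat (hfl : IsRoundNearest p emin fl) :
    ∀ {l : List ℚ}, (∀ x ∈ l, IsFloat p emin x) → IsFloat p emin (estimate fl l) := by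
  intro l
  induction l using List.reverseRecOn with
  | nil => intro; exact ⟨0, emin, by simp, le_rfl, by simp [estimate]⟩
  | append_singleton l a _ =>
    intro h
    by_cases hl : l = []
    · subst hl; simpa [estimate] using h a (by simp)
    · rw [estimate_snoc fl hl]; exact (hfl _).1

/-- Round-to-nearest moves a point of the float grid `2^emin` of magnitude `< 2^g` by at most
`2^g·2^-p/2` (when `2^(g-p) < 2^emin` such a point is a float and does not move at all). -/
private theorem abs_fl_sub_le_half (hp : 1 ≤ p) (hfl : IsRoundNearest p emin fl) {t : ℚ}
    (htg : OnGrid emin t) {g : ℤ} (ht : |t| < (2 : ℚ) ^ g) :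
    |fl t - t| ≤ (2 : ℚ) ^ g / 2 ^ p / 2 := by
  have h2ne : (2 : ℚ) ≠ 0 := by norm_num
  have hgp : (2 : ℚ) ^ (g - p) = (2 : ℚ) ^ g / 2 ^ p := by rw [zpow_sub₀ h2ne, zpow_natCast]
  rcases lt_or_ge (g - p) emin with hg | hg
  · obtain ⟨r, hr⟩ := htg
    have h2e : (0 : ℚ) < (2 : ℚ) ^ emin := zpow_pos (by norm_num) _
    have hlt : |t| < (2 : ℚ) ^ p * (2 : ℚ) ^ emin := by
      rw [← zpow_natCast, ← zpow_add₀ h2ne]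
      exact ht.trans_le (zpow_le_zpow_right₀ (by norm_num) (by omega))
    rw [hr, abs_mul, abs_of_pos h2e] at hlt
    have hr' : |r| ≤ (2 : ℤ) ^ p := by exact_mod_cast (lt_of_mul_lt_mul_right hlt h2e.le).le
    rw [fl_eq_self hfl (hr ▸ isFloat_of_abs_le hp hr' le_rfl), sub_self, abs_zero, ← hgp]
    exact div_nonneg (zpow_pos (by norm_num) _).le (by norm_num)
  · rw [abs_sub_comm, ← hgp]
    refine (abs_sub_fl_le_half_ulp hp hfl t).trans (div_le_div_of_nonneg_right ?_ (by norm_num))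
    by_cases ht0 : t = 0
    · rw [ht0, ulp_zero]; exact zpow_le_zpow_right₀ (by norm_num) hg
    · rw [ulp_of_ne_zero ht0]
      refine zpow_le_zpow_right₀ (by norm_num) (max_le hg ?_)
      by_contra hlt
      have h1 := zpow_log_le_abs ht0
      have h2 : (2 : ℚ) ^ g ≤ (2 : ℚ) ^ (Int.log 2 |t|) :=
        zpow_le_zpow_right₀ (by norm_num) (by omega)
      linarith

/-- **APPROXIMATE on a NONADJACENT expansion.** For floats forming a nonadjacent expansion
with `2|x| < 2^s` for every component, the computed value satisfies `|estimate| ≤ 2^s/2` and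
`|estimate − Σ| ≤ 2^s·2^-p/3`, for ANY round-to-nearest (no tie rule needed here). -/
theorem estimate_bounds_of_nonadjacent (hp : 1 ≤ p) (hfl : IsRoundNearest p emin fl) :
    ∀ {l : List ℚ}, (∀ x ∈ l, IsFloat p emin x) → IsExpansion 2 l →
      ∀ {s : ℤ}, (∀ x ∈ l, 2 * |x| < (2 : ℚ) ^ s) →
        |estimate fl l| ≤ (2 : ℚ) ^ s / 2 ∧
          |estimate fl l - l.sum| ≤ (2 : ℚ) ^ s / 2 ^ p / 3 := by
  have h2ne : (2 : ℚ) ≠ 0 := by norm_num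
  have hP : (0 : ℚ) < (2 : ℚ) ^ p := by positivity
  intro l
  induction l using List.reverseRecOn with
  | nil =>
    intro _ _ s _
    have h2s : (0 : ℚ) < (2 : ℚ) ^ s := zpow_pos (by norm_num) _
    rw [show estimate fl ([] : List ℚ) = 0 from rfl, List.sum_nil, sub_self, abs_zero]
    exact ⟨by linarith, div_nonneg (div_nonneg h2s.le hP.le) (by norm_num)⟩
  | append_singleton l a ih =>
    intro hF hE s hs
    have hFl : ∀ x ∈ l, IsFloat p emin x := fun x hx => hF x (List.mem_append_left _ hx)
    have hFa : IsFloat p emin a := hF a (by simp)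
    have hEl : IsExpansion 2 l := (List.pairwise_append.mp hE).1
    have hbelow : ∀ x ∈ l, Below 2 x a := fun x hx =>
      (List.pairwise_append.mp hE).2.2 x hx a (by simp)
    have hsl : ∀ x ∈ l, 2 * |x| < (2 : ℚ) ^ s := fun x hx => hs x (List.mem_append_left _ hx)
    have hsa : 2 * |a| < (2 : ℚ) ^ s := hs a (by simp)
    have h2s : (0 : ℚ) < (2 : ℚ) ^ s := zpow_pos (by norm_num) _
    by_cases hl : l = []
    · subst hl
      rw [List.nil_append, show estimate fl [a] = a from rfl, List.sum_singleton, sub_self,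
        abs_zero]
      exact ⟨by linarith, div_nonneg (div_nonneg h2s.le hP.le) (by norm_num)⟩
    rw [estimate_snoc fl hl, List.sum_append, List.sum_singleton]
    set Q := estimate fl l with hQdef
    have hQF : IsFloat p emin Q := estimate_isFloat hfl hFl
    by_cases ha0 : a = 0
    · rw [ha0, add_zero, add_zero, fl_eq_self hfl hQF]; exact ih hFl hEl hsl
    obtain ⟨M, v, hMo, -, hev, hav⟩ := exists_odd_mul_two_zpow hFa ha0
    have h2v : (0 : ℚ) < (2 : ℚ) ^ v := zpow_pos (by norm_num) _
    have hv : ∀ x ∈ l, 2 * |x| < (2 : ℚ) ^ v := fun x hx => by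
      obtain ⟨s', hs', hxs'⟩ := hbelow x hx
      rw [hav] at hs'
      exact hxs'.trans_le (zpow_le_zpow_right₀ (by norm_num) (OnGrid.le_of_odd hMo hs'))
    obtain ⟨hQv, hEv⟩ := ih hFl hEl hv
    have hag : OnGrid v a := ⟨M, hav⟩
    have hva : (2 : ℚ) ^ v ≤ |a| := hag.two_zpow_le_abs ha0
    have hs1 : (2 : ℚ) ^ (s - 1) = (2 : ℚ) ^ s / 2 := by rw [zpow_sub_one₀ h2ne]; ring
    have halt : |a| < (2 : ℚ) ^ (s - 1) := by rw [hs1]; linarith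
    have hvs : v < s - 1 := (zpow_lt_zpow_iff_right₀ one_lt_two).mp (hva.trans_lt halt)
    have hsum : |a| + (2 : ℚ) ^ v ≤ (2 : ℚ) ^ (s - 1) :=
      hag.abs.add_two_zpow_le (OnGrid.two_zpow (by omega)) halt
    set T := Q + a with hTdef
    have hTle : |T| ≤ (2 : ℚ) ^ (s - 1) - (2 : ℚ) ^ v / 2 := by
      have : |T| ≤ |Q| + |a| := abs_add_le _ _
      linarith
    have hTg : OnGrid emin T := (OnGrid.of_isFloat hQF).add (OnGrid.of_isFloat hFa)
    have herr : |fl T - T| ≤ (2 : ℚ) ^ (s - 1) / 2 ^ p / 2 :=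
      abs_fl_sub_le_half hp hfl hTg (by linarith)
    rw [hs1] at herr
    have hv4 : (2 : ℚ) ^ v ≤ (2 : ℚ) ^ s / 4 := by
      have h1 : (2 : ℚ) ^ v ≤ (2 : ℚ) ^ (s - 2) := zpow_le_zpow_right₀ (by norm_num) (by omega)
      have h2 : (2 : ℚ) ^ (s - 2) = (2 : ℚ) ^ s / 4 := by rw [zpow_sub₀ h2ne]; norm_num
      linarith
    have hcap : |fl T| ≤ (2 : ℚ) ^ s / 2 := by
      rw [← hs1]
      exact abs_fl_le_of_abs_le hfl (isFloat_two_zpow hp (by omega)) (by linarith)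
    refine ⟨hcap, ?_⟩
    have hsplit : fl T - (l.sum + a) = (fl T - T) + (Q - l.sum) := by rw [hTdef]; ring
    rw [hsplit]
    refine (abs_add_le _ _).trans ?_
    have hEv' : |Q - l.sum| ≤ (2 : ℚ) ^ s / 4 / 2 ^ p / 3 :=
      hEv.trans (div_le_div_of_nonneg_right (div_le_div_of_nonneg_right hv4 hP.le) (by norm_num))
    have hfin : (2 : ℚ) ^ s / 2 / 2 ^ p / 2 + (2 : ℚ) ^ s / 4 / 2 ^ p / 3 =
        (2 : ℚ) ^ s / 2 ^ p / 3 := by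
      field_simp; ring
    linarith

/-- **The grid argument.** `fl T` is the computed value, `S` the exact one, `|T − S| ≤ θ`. If
`fl T` and every float of magnitude `≥ |S| − θ` lie on a grid `2^g` with `2θ < 2^g`, then no
float lies strictly between `S` and `fl T`: round-to-nearest minimality puts `T` beyond such a
float `F` (so `|F − S| ≤ θ`) and within `θ` of it, whence `|fl T − F| ≤ 2θ < 2^g ≤ |fl T − F|`. -/
private theorem isFaithful_of_grid (hfl : IsRoundNearest p emin fl) {T S θ : ℚ} {g : ℤ}
    (hθ : |T - S| ≤ θ) (hθg : 2 * θ < (2 : ℚ) ^ g) (hAg : OnGrid g (fl T))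
    (hFg : ∀ F : ℚ, IsFloat p emin F → |S| - θ ≤ |F| → OnGrid g F) :
    IsFaithful p emin S (fl T) := by
  have hA : IsFloat p emin (fl T) := (hfl T).1
  have h1 : fl T - T ≤ |T - fl T| := by rw [abs_sub_comm]; exact le_abs_self _
  have h2 : T - fl T ≤ |T - fl T| := le_abs_self _
  have hθ1 : T - S ≤ θ := (le_abs_self _).trans hθ
  have hθ2 : S - T ≤ θ := by linarith [neg_abs_le (T - S)]
  rcases le_total S (fl T) with hSA | hAS
  · -- `S ≤ fl T`: `fl T = RU S`, i.e. no float `F` with `S ≤ F < fl T`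
    refine Or.inr ⟨hA, hSA, fun F hF hSF => not_lt.mp fun hFA => ?_⟩
    have hmin : |T - fl T| ≤ |T - F| := (hfl T).2 F hF
    have hTF : F < T := not_le.mp fun hle => by
      rw [abs_of_nonpos (sub_nonpos.mpr hle)] at hmin
      linarith
    rw [abs_of_pos (sub_pos.mpr hTF)] at hmin
    have hSF' := abs_sub_abs_le_abs_sub S F
    rw [abs_of_nonpos (sub_nonpos.mpr hSF)] at hSF'
    have hgap := OnGrid.add_two_zpow_le (hFg F hF (by linarith)) hAg hFA
    linarith
  · -- `fl T ≤ S`: `fl T = RD S`, i.e. no float `F` with `fl T < F ≤ S`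
    refine Or.inl ⟨hA, hAS, fun F hF hFS => not_lt.mp fun hAF => ?_⟩
    have hmin : |T - fl T| ≤ |T - F| := (hfl T).2 F hF
    have hTF : T < F := not_le.mp fun hle => by
      rw [abs_of_nonneg (sub_nonneg.mpr hle)] at hmin
      linarith
    rw [abs_of_neg (sub_neg.mpr hTF)] at hmin
    have hSF' := abs_sub_abs_le_abs_sub S F
    rw [abs_of_nonneg (sub_nonneg.mpr hFS)] at hSF'
    have hgap := OnGrid.add_two_zpow_le hAg (hFg F hF (by linarith)) hAF
    linarith

/-- A float of magnitude at least `2^(k+p-2)` lies on the grid `2^(k-1)`. -/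
private theorem onGrid_of_le_abs {F : ℚ} (hF : IsFloat p emin F) {k : ℤ}
    (hkF : (2 : ℚ) ^ (k + p - 2) ≤ |F|) : OnGrid (k - 1) F := by
  obtain ⟨K, hK⟩ := exists_eq_int_mul_two_zpow_of_isFloat hF hkF
  exact ⟨K, by rw [hK, show k + (p : ℤ) - 2 - p + 1 = k - 1 by ring]⟩

/-- **APPROXIMATE ∘ COMPRESS is a faithful rounding** (`p ≥ 3`; round-to-nearest with
nonadjacent roundoff, e.g. round-half-to-even). For every nonoverlapping expansion `e` of floats,
`estimate fl (compress fl e)` is `RD (Σ e)` or `RU (Σ e)`: a float with no float strictly between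
it and the exact value. -/
theorem estimate_compress_faithful (hp : 3 ≤ p) (hfl : IsRoundNearest p emin fl)
    (hfl2 : RoundoffBelow 2 fl) {e : List ℚ} (he : ∀ x ∈ e, IsFloat p emin x)
    (hexp : IsExpansion 1 e) : IsFaithful p emin e.sum (estimate fl (compress fl e)) := by
  have h2ne : (2 : ℚ) ≠ 0 := by norm_num
  have hp1 : 1 ≤ p := by omega
  have hP : (0 : ℚ) < (2 : ℚ) ^ p := by positivity
  have out := compress_spec (by omega : 2 ≤ p) hfl (c := 2) (by norm_num) hfl2 he hexp
  set h := compress fl e with hh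
  rw [← out.sum_eq]
  rcases List.eq_nil_or_concat h with h0 | ⟨rest, L, hrl⟩
  · rw [h0, show estimate fl ([] : List ℚ) = 0 from rfl, List.sum_nil]
    exact Or.inl (isRD_self (isFloat_zero p emin))
  rw [List.concat_eq_append] at hrl
  have hLF : IsFloat p emin L := out.floats L (by rw [hrl]; simp)
  by_cases hr : rest = []
  · subst hr
    rw [hrl, List.nil_append, show estimate fl [L] = L from rfl, List.sum_singleton]
    exact Or.inl (isRD_self hLF)
  -- the generic case `h = rest ++ [L]`, `rest ≠ []`
  have hrF : ∀ y ∈ rest, IsFloat p emin y := fun y hy =>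
    out.floats y (by rw [hrl]; exact List.mem_append_left _ hy)
  have hexp2 : IsExpansion 2 (rest ++ [L]) := hrl ▸ out.exp
  have hEr : IsExpansion 2 rest := (List.pairwise_append.mp hexp2).1
  have hbelow : ∀ y ∈ rest, Below 2 y L := fun y hy =>
    (List.pairwise_append.mp hexp2).2.2 y hy L (by simp)
  have hL0 : L ≠ 0 := out.nz.elim (fun hnz => hnz L (by rw [hrl]; simp)) fun hsingle => by
    obtain ⟨r, rs, rfl⟩ := List.exists_cons_of_ne_nil hr
    rw [hrl] at hsingle
    simp at hsingle
  have hsum : h.sum = rest.sum + L := by rw [hrl, List.sum_append, List.sum_singleton]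
  have happ : |rest.sum| < ulp p emin L := by
    have := out.approx L (by rw [hrl]; simp)
    rwa [hsum, add_sub_cancel_right] at this
  have hA : estimate fl h = fl (estimate fl rest + L) := by rw [hrl, estimate_snoc fl hr]
  rw [hA, hsum]
  -- `L = M·2^v` with `M` odd: everything below `L` lives under `2^v / 2`
  obtain ⟨M, v, hMo, -, -, hLv⟩ := exists_odd_mul_two_zpow hLF hL0
  have hv : ∀ y ∈ rest, 2 * |y| < (2 : ℚ) ^ v := fun y hy => by
    obtain ⟨s', hs', hys'⟩ := hbelow y hy
    rw [hLv] at hs'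
    exact hys'.trans_le (zpow_le_zpow_right₀ (by norm_num) (OnGrid.le_of_odd hMo hs'))
  obtain ⟨-, hθ⟩ := estimate_bounds_of_nonadjacent hp1 hfl hrF hEr hv
  set Q := estimate fl rest with hQdef
  set R := rest.sum with hRdef
  have hvL : (2 : ℚ) ^ v ≤ |L| := (show OnGrid v L from ⟨M, hLv⟩).two_zpow_le_abs hL0
  -- the unit in the last place of `L`
  obtain ⟨k, hk, hU⟩ := exists_ulp_eq_two_zpow (p := p) (emin := emin) L
  have h2k : (0 : ℚ) < (2 : ℚ) ^ k := zpow_pos (by norm_num) _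
  have hLU : |L| < (2 : ℚ) ^ p * (2 : ℚ) ^ k :=
    hU ▸ abs_lt_two_pow_mul_ulp (p := p) (emin := emin) L
  rw [hU] at happ
  have hvk : (2 : ℚ) ^ v / 2 ^ p ≤ (2 : ℚ) ^ k / 2 := by
    have h1 : (2 : ℚ) ^ v < (2 : ℚ) ^ (k + p) := by
      rw [zpow_add₀ h2ne, zpow_natCast, mul_comm]; exact hvL.trans_lt hLU
    have h2 : v ≤ k + p - 1 := by
      have := (zpow_lt_zpow_iff_right₀ (one_lt_two (α := ℚ))).mp h1; omega
    have h3 : (2 : ℚ) ^ (k + p - 1) = (2 : ℚ) ^ k / 2 * 2 ^ p := by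
      rw [zpow_sub_one₀ h2ne, zpow_add₀ h2ne, zpow_natCast]; ring
    rw [div_le_iff₀ hP, ← h3]; exact zpow_le_zpow_right₀ (by norm_num) h2
  have hθ' : |Q + L - (R + L)| ≤ (2 : ℚ) ^ v / 2 ^ p / 3 := by
    rwa [show Q + L - (R + L) = Q - R by ring]
  rcases eq_or_lt_of_le hk with hke | hke
  · -- `ulp L = 2^emin`: every float is a multiple of `2^k`
    exact isFaithful_of_grid hfl hθ' (by linarith) ((OnGrid.of_isFloat (hfl _).1).mono hke.symm.le)
      fun F hF _ => (OnGrid.of_isFloat hF).mono hke.symm.le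
  -- `emin < k`: `L` is normal, `2^(k+p-1) ≤ |L|`; grid `2^(k-1)` from magnitude `2^(k+p-2)` on
  have hLbig : (2 : ℚ) ^ (k + p - 1) ≤ |L| := by
    have hulp := ulp_of_ne_zero (p := p) (emin := emin) hL0
    rw [hU] at hulp
    have hmax : k = max emin (Int.log 2 |L| - p + 1) :=
      zpow_right_injective₀ (by norm_num) (by norm_num) hulp
    have hlog : Int.log 2 |L| = k + p - 1 := by
      rcases max_choice emin (Int.log 2 |L| - p + 1) with hm | hm <;> rw [hm] at hmax <;> omega
    have := zpow_log_le_abs hL0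
    rwa [hlog] at this
  have hkp : emin ≤ k + p - 2 := by omega
  have h2kp : (0 : ℚ) < (2 : ℚ) ^ (k + p - 2) := zpow_pos (by norm_num) _
  have hkk : (2 : ℚ) ^ (k + p - 2) * 2 = (2 : ℚ) ^ (k + p - 1) := by
    rw [show k + (p : ℤ) - 1 = k + p - 2 + 1 by ring, zpow_add_one₀ h2ne]
  have hk4 : (2 : ℚ) ^ k * 4 ≤ (2 : ℚ) ^ (k + p - 1) := by
    rw [show (2 : ℚ) ^ k * 4 = (2 : ℚ) ^ (k + 2) by rw [zpow_add₀ h2ne]; norm_num]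
    exact zpow_le_zpow_right₀ (by norm_num) (by omega)
  -- magnitudes of the exact value `R + L`, of `Q + L`, and of the result
  have hS : (2 : ℚ) ^ (k + p - 1) - (2 : ℚ) ^ k < |R + L| := by
    have := abs_sub (R + L) R
    rw [show R + L - R = L by ring] at this
    linarith
  have hT : (2 : ℚ) ^ (k + p - 2) ≤ |Q + L| := by
    have := abs_sub (Q + L) (Q + L - (R + L))
    rw [show Q + L - (Q + L - (R + L)) = R + L by ring] at this
    linarith
  have hAabs : (2 : ℚ) ^ (k + p - 2) ≤ |fl (Q + L)| := by
    have := abs_le_abs_fl hfl (isFloat_two_zpow hp1 hkp)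
      (show |(2 : ℚ) ^ (k + p - 2)| ≤ |Q + L| by rwa [abs_of_pos h2kp])
    rwa [abs_of_pos h2kp] at this
  exact isFaithful_of_grid hfl hθ' (by rw [zpow_sub_one₀ h2ne]; linarith)
    (onGrid_of_le_abs (hfl _).1 hAabs) fun F hF hSF => onGrid_of_le_abs hF (by linarith)

/-- If the exact value is representable, APPROXIMATE ∘ COMPRESS returns it exactly. -/
theorem estimate_compress_eq_sum (hp : 3 ≤ p) (hfl : IsRoundNearest p emin fl)
    (hfl2 : RoundoffBelow 2 fl) {e : List ℚ} (he : ∀ x ∈ e, IsFloat p emin x)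
    (hexp : IsExpansion 1 e) (hS : IsFloat p emin e.sum) : estimate fl (compress fl e) = e.sum :=
  (estimate_compress_faithful hp hfl hfl2 he hexp).eq_self hS

/-- **Error below one ulp of the exact value** (Property 2.8 of Boldo–Jeannerod–Melquiond–Muller):
`|estimate (compress e) − Σ e| < ulp (Σ e)`. -/
theorem abs_estimate_compress_sub_sum_lt_ulp (hp : 3 ≤ p) (hfl : IsRoundNearest p emin fl)
    (hfl2 : RoundoffBelow 2 fl) {e : List ℚ} (he : ∀ x ∈ e, IsFloat p emin x)
    (hexp : IsExpansion 1 e) : |estimate fl (compress fl e) - e.sum| < ulp p emin e.sum :=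
  abs_sub_lt_ulp_of_isFaithful (by omega) (estimate_compress_faithful hp hfl hfl2 he hexp)

/-- APPROXIMATE ∘ COMPRESS has exactly the sign of the exact value — the property plain
APPROXIMATE lacks on nonoverlapping input (`⟨15/16, 15, −16⟩ ↦ 0`). -/
theorem estimate_compress_pos_iff (hp : 3 ≤ p) (hfl : IsRoundNearest p emin fl)
    (hfl2 : RoundoffBelow 2 fl) {e : List ℚ} (he : ∀ x ∈ e, IsFloat p emin x)
    (hexp : IsExpansion 1 e) : 0 < estimate fl (compress fl e) ↔ 0 < e.sum := by
  have hf := estimate_compress_faithful hp hfl hfl2 he hexp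
  refine ⟨fun hA => not_le.mp fun hS => ?_, fun hS => ?_⟩
  · exact absurd (hf.le_of_le (isFloat_zero p emin) hS) (not_le.mpr hA)
  · -- `Σ e` is a positive multiple of `2^emin`, and `2^emin` is a float below it
    have hg : OnGrid emin e.sum := OnGrid.listSum fun x hx => OnGrid.of_isFloat (he x hx)
    have hle : (2 : ℚ) ^ emin ≤ e.sum := by
      have := hg.two_zpow_le_abs hS.ne'
      rwa [abs_of_pos hS] at this
    exact lt_of_lt_of_le (zpow_pos (by norm_num) _)
      (hf.ge_of_ge (isFloat_two_zpow (by omega) le_rfl) hle)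

/-- Mirror of `estimate_compress_pos_iff`; together they also give `= 0 ↔ Σ e = 0`. -/
theorem estimate_compress_neg_iff (hp : 3 ≤ p) (hfl : IsRoundNearest p emin fl)
    (hfl2 : RoundoffBelow 2 fl) {e : List ℚ} (he : ∀ x ∈ e, IsFloat p emin x)
    (hexp : IsExpansion 1 e) : estimate fl (compress fl e) < 0 ↔ e.sum < 0 := by
  have hf := estimate_compress_faithful hp hfl hfl2 he hexp
  refine ⟨fun hA => not_le.mp fun hS => ?_, fun hS => ?_⟩
  · exact absurd (hf.ge_of_ge (isFloat_zero p emin) hS) (not_le.mpr hA)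
  · have hg : OnGrid emin e.sum := OnGrid.listSum fun x hx => OnGrid.of_isFloat (he x hx)
    have hle : e.sum ≤ -(2 : ℚ) ^ emin := by
      have := hg.two_zpow_le_abs hS.ne
      rw [abs_of_neg hS] at this
      linarith
    exact lt_of_le_of_lt (hf.le_of_le (isFloat_two_zpow (by omega) le_rfl).neg hle)
      (neg_neg_of_pos (zpow_pos (by norm_num) _))

/-- The round-half-to-even instance (`fl = roundTiesEven p emin`, IEEE 754's default). -/
theorem estimate_compress_faithful_roundTiesEven (hp : 3 ≤ p) {e : List ℚ}
    (he : ∀ x ∈ e, IsFloat p emin x) (hexp : IsExpansion 1 e) :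
    IsFaithful p emin e.sum
      (estimate (roundTiesEven p emin) (compress (roundTiesEven p emin) e)) :=
  estimate_compress_faithful hp (isRoundNearest_roundTiesEven (by omega))
    (roundoffBelow_two_roundTiesEven p emin) he hexp

end Summit.Ventures.CertifiedArithmetic.Expansions
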